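import Summits.Ventures.LatticeQCDFlow.Scoring.OnePlaquetteHaarMGF
import Summits.Ventures.LatticeQCDFlow.TrivializingMaps.UNHaarTraceMoments
import HarnessLib

/-!
# Cumulants and limits of the `U(N)` one-plaquette law for every `N`: slope `1/(2N)` at `β = 0`, variance `= (log det)''/N²`, plaquette `→ 1` as `β → ∞`

HONEST FRAMING: exact (Metropolis-corrected) sampling algorithms for lattice gauge theory;
figures of merit are autocorrelation/cost numbers at stated couplings and volumes; no
continuum-physics claim.

Venture `LatticeQCDFlow` (cell pub-lqcd), sub-topic `Scoring`; FANOUT row 5 (`s0-sun-a`), GEN-17.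
NEW WORK of the cell (placement rule).  Sequel of `OnePlaquetteHaarMGF.lean` (`∫_{U(N)} e^{x Re tr U} dU =
det[I_{|i−j|}(x)] = mgf_{Re tr}(x)`, plaquette `= (1/N)(log det)'`, monotone).  For the `U(N)` one-plaquette law of
theory 2 (`e^{−β(N − Re tr U)} dU`), every `N ≥ 1`:

* §1 **strong coupling** (with theory-1's Haar moments `∫_{U(N)} Re tr = 0`, `∫_{U(N)} (Re tr)² = ½`,
  `TrivializingMaps.UNHaarTraceMoments`): `(log det[I_{|i−j|}])'(0) = 0`, `(log det[I_{|i−j|}])''(0) = ½`, and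
  **the plaquette has slope exactly `1/(2N)` at `β = 0`**;
* §2 **the error-bar oracle**: the VARIANCE of the plaquette `(1/N) Re tr U_p` at coupling `β` is exactly
  `(1/N²)·(log det[I_{|i−j|}])''(β)` (the per-plaquette unit `v` of the ideal-sampler error bar `√(v/(Vn))`);
* §3 **tilted means tend to the supremum** (general: bounded measurable `X ≤ M` on a probability space with
  `μ{X > M − ε} > 0` ⇒ `(cgf X μ)'(t) → M`), hence §4 **weak coupling**: `(log det[I_{|i−j|}])'(β) → N` and
  **the plaquette `→ 1` as `β → ∞`** (`Re tr ≤ N`, `= N` at `1`, open sets have positive Haar measure).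

So for every `N` the `U(N)` plaquette rises monotonically from `0` (slope `1/(2N)`) to `1`.  The `SU(N)` twins are in
`SUNOnePlaquetteHaarMGF.lean`.  No `def`, nothing cited as a fact, 0 sorry.
-/

noncomputable section

open Real MeasureTheory Filter Topology Finset Complex Set
open scoped ENNReal
open ProbabilityTheory
open Literature.MathematicalPhysics.QuantumFieldTheory
open Literature.MathematicalPhysics.QuantumLattice
open Literature.Analysis.FunctionSpaces

namespace Summit.Ventures.LatticeQCDFlow.Scoring

/-! ### 1. Strong coupling: `(log det)'(0) = 0`, `(log det)''(0) = ½`, slope `1/(2N)` -/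

section StrongCoupling

open Summit.Ventures.LatticeQCDFlow.TrivializingMaps

/-- **`U(N)`, `β = 0`**: `(log det[I_{|i−j|}])'(0) = ∫_{U(N)} Re tr U dU = 0`. -/
theorem deriv_log_det_besselI_toeplitz_zero (N : ℕ) :
    deriv (fun x : ℝ => Real.log (Matrix.of fun i j : Fin N => besselI ((i : ℤ) - (j : ℤ)).natAbs x).det) 0 = 0 := by
  have hcgf : (fun x : ℝ => Real.log (Matrix.of fun i j : Fin N => besselI ((i : ℤ) - (j : ℤ)).natAbs x).det)
      = cgf (fun u : Matrix.unitaryGroup (Fin N) ℂ => ((u : Matrix.unitaryGroup (Fin N) ℂ) :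
          Matrix (Fin N) (Fin N) ℂ).trace.re) (haarProbability (Matrix.unitaryGroup (Fin N) ℂ)) :=
    funext fun x => by rw [cgf, mgf_trace_re_unitaryGroup]
  rw [hcgf, deriv_cgf_zero (mem_interior_integrableExpSet_of_abs_le_const
    (aestronglyMeasurable_trace_re_unitaryGroup N) (fun u => abs_trace_re_le_card u) 0), un_integral_re_trace, zero_div]

/-- **`U(N)`, `β = 0`**: `(log det[I_{|i−j|}])''(0) = Var_{Haar}(Re tr U) = ½` for every `N ≥ 1`. -/
theorem iteratedDeriv_two_log_det_besselI_toeplitz_zero (N : ℕ) [NeZero N] :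
    iteratedDeriv 2 (fun x : ℝ => Real.log (Matrix.of fun i j : Fin N => besselI ((i : ℤ) - (j : ℤ)).natAbs x).det) 0
      = 1 / 2 := by
  have hint := mem_interior_integrableExpSet_of_abs_le_const
    (aestronglyMeasurable_trace_re_unitaryGroup N) (fun u => abs_trace_re_le_card u) 0
  have hcgf : (fun x : ℝ => Real.log (Matrix.of fun i j : Fin N => besselI ((i : ℤ) - (j : ℤ)).natAbs x).det)
      = cgf (fun u : Matrix.unitaryGroup (Fin N) ℂ => ((u : Matrix.unitaryGroup (Fin N) ℂ) :
          Matrix (Fin N) (Fin N) ℂ).trace.re) (haarProbability (Matrix.unitaryGroup (Fin N) ℂ)) :=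
    funext fun x => by rw [cgf, mgf_trace_re_unitaryGroup]
  rw [hcgf, iteratedDeriv_two_cgf hint, deriv_cgf_zero hint, un_integral_re_trace, mgf_zero]
  simp only [zero_mul, Real.exp_zero, mul_one, zero_div, div_one]
  rw [un_haarSqReTrace_eq_half (Nat.one_le_iff_ne_zero.2 (NeZero.ne N))]
  norm_num

/-- **THE `U(N)` PLAQUETTE HAS SLOPE `1/(2N)` AT `β = 0`, FOR EVERY `N ≥ 1`.** -/
theorem hasDerivAt_unitary_plaquette_zero (N : ℕ) [NeZero N] :
    HasDerivAt (fun β : ℝ =>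
      (∫ u, ((u : Matrix.unitaryGroup (Fin N) ℂ) : Matrix (Fin N) (Fin N) ℂ).trace.re / N *
          Real.exp (-(β * ((N : ℝ) - ((u : Matrix.unitaryGroup (Fin N) ℂ) : Matrix (Fin N) (Fin N) ℂ).trace.re)))
        ∂(haarProbability (Matrix.unitaryGroup (Fin N) ℂ)))
      / (∫ u, Real.exp (-(β * ((N : ℝ) - ((u : Matrix.unitaryGroup (Fin N) ℂ) : Matrix (Fin N) (Fin N) ℂ).trace.re)))
        ∂(haarProbability (Matrix.unitaryGroup (Fin N) ℂ)))) (1 / (2 * N)) 0 := by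
  simp_rw [unitary_plaquette_eq_deriv_log_det]
  have ha := (analyticOnNhd_cgf_univ (aestronglyMeasurable_trace_re_unitaryGroup N)
    (fun u => abs_trace_re_le_card u))
  have hcgf : (fun x : ℝ => Real.log (Matrix.of fun i j : Fin N => besselI ((i : ℤ) - (j : ℤ)).natAbs x).det)
      = cgf (fun u : Matrix.unitaryGroup (Fin N) ℂ => ((u : Matrix.unitaryGroup (Fin N) ℂ) :
          Matrix (Fin N) (Fin N) ℂ).trace.re) (haarProbability (Matrix.unitaryGroup (Fin N) ℂ)) :=
    funext fun x => by rw [cgf, mgf_trace_re_unitaryGroup]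
  have h2 := iteratedDeriv_two_log_det_besselI_toeplitz_zero N
  rw [iteratedDeriv_succ, iteratedDeriv_one] at h2
  have hd : HasDerivAt (deriv fun x : ℝ =>
      Real.log (Matrix.of fun i j : Fin N => besselI ((i : ℤ) - (j : ℤ)).natAbs x).det) (1 / 2) 0 := by
    rw [← h2]
    rw [hcgf]
    exact ((ha 0 (Set.mem_univ 0)).deriv).differentiableAt.hasDerivAt
  have h := hd.const_mul (1 / (N : ℝ))
  refine h.congr_deriv ?_
  ring

end StrongCoupling

/-! ### 2. The plaquette variance is `(log det)''/N²` -/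

/-- **`U(N)`: the variance of the plaquette `(1/N) Re tr U` under the one-plaquette law at coupling `β` is
`(1/N²) · (log det[I_{|i−j|}])''(β)`.** -/
theorem unitary_plaquette_variance_eq (N : ℕ) (β : ℝ) :
    (∫ u, (((u : Matrix.unitaryGroup (Fin N) ℂ) : Matrix (Fin N) (Fin N) ℂ).trace.re / N) ^ 2 *
          Real.exp (-(β * ((N : ℝ) - ((u : Matrix.unitaryGroup (Fin N) ℂ) : Matrix (Fin N) (Fin N) ℂ).trace.re)))
        ∂(haarProbability (Matrix.unitaryGroup (Fin N) ℂ)))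
      / (∫ u, Real.exp (-(β * ((N : ℝ) - ((u : Matrix.unitaryGroup (Fin N) ℂ) : Matrix (Fin N) (Fin N) ℂ).trace.re)))
        ∂(haarProbability (Matrix.unitaryGroup (Fin N) ℂ)))
      - ((∫ u, ((u : Matrix.unitaryGroup (Fin N) ℂ) : Matrix (Fin N) (Fin N) ℂ).trace.re / N *
          Real.exp (-(β * ((N : ℝ) - ((u : Matrix.unitaryGroup (Fin N) ℂ) : Matrix (Fin N) (Fin N) ℂ).trace.re)))
        ∂(haarProbability (Matrix.unitaryGroup (Fin N) ℂ)))
      / (∫ u, Real.exp (-(β * ((N : ℝ) - ((u : Matrix.unitaryGroup (Fin N) ℂ) : Matrix (Fin N) (Fin N) ℂ).trace.re)))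
        ∂(haarProbability (Matrix.unitaryGroup (Fin N) ℂ)))) ^ 2
      = 1 / N ^ 2 * iteratedDeriv 2 (fun x : ℝ =>
          Real.log (Matrix.of fun i j : Fin N => besselI ((i : ℤ) - (j : ℤ)).natAbs x).det) β := by
  have hint := mem_interior_integrableExpSet_of_abs_le_const
    (aestronglyMeasurable_trace_re_unitaryGroup N) (fun u => abs_trace_re_le_card u) β
  have hcgf : (fun x : ℝ => Real.log (Matrix.of fun i j : Fin N => besselI ((i : ℤ) - (j : ℤ)).natAbs x).det)
      = cgf (fun u : Matrix.unitaryGroup (Fin N) ℂ => ((u : Matrix.unitaryGroup (Fin N) ℂ) :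
          Matrix (Fin N) (Fin N) ℂ).trace.re) (haarProbability (Matrix.unitaryGroup (Fin N) ℂ)) :=
    funext fun x => by rw [cgf, mgf_trace_re_unitaryGroup]
  rw [unitary_plaquette_eq_deriv_log_det, hcgf, iteratedDeriv_two_cgf hint, deriv_cgf hint, mgf]
  have hsplit : ∀ u : Matrix.unitaryGroup (Fin N) ℂ,
      Real.exp (-(β * ((N : ℝ) - ((u : Matrix.unitaryGroup (Fin N) ℂ) : Matrix (Fin N) (Fin N) ℂ).trace.re)))
        = Real.exp (-(N * β)) * Real.exp (β * ((u : Matrix.unitaryGroup (Fin N) ℂ) : Matrix (Fin N) (Fin N) ℂ).trace.re) := by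
    intro u; rw [← Real.exp_add]; congr 1; ring
  simp_rw [hsplit]
  have h1 : ∀ u : Matrix.unitaryGroup (Fin N) ℂ,
      (((u : Matrix.unitaryGroup (Fin N) ℂ) : Matrix (Fin N) (Fin N) ℂ).trace.re / N) ^ 2 *
        (Real.exp (-(N * β)) * Real.exp (β * ((u : Matrix.unitaryGroup (Fin N) ℂ) : Matrix (Fin N) (Fin N) ℂ).trace.re))
      = Real.exp (-(N * β)) / N ^ 2 * (((u : Matrix.unitaryGroup (Fin N) ℂ) : Matrix (Fin N) (Fin N) ℂ).trace.re ^ 2 *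
          Real.exp (β * ((u : Matrix.unitaryGroup (Fin N) ℂ) : Matrix (Fin N) (Fin N) ℂ).trace.re)) := by
    intro u; ring
  simp_rw [h1]
  rw [integral_const_mul, integral_const_mul]
  have hZ : 0 < ∫ u, Real.exp (β * ((u : Matrix.unitaryGroup (Fin N) ℂ) : Matrix (Fin N) (Fin N) ℂ).trace.re)
      ∂(haarProbability (Matrix.unitaryGroup (Fin N) ℂ)) := by
    rw [integral_haar_unitaryGroup_fin_exp_mul_trace_re]; exact det_besselI_toeplitz_fin_pos N β
  have he : Real.exp (-(N * β)) ≠ 0 := (Real.exp_pos _).ne'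
  by_cases hN : (N : ℝ) = 0
  · simp [hN]
  · field_simp


/-! ### 3. Tilted means of a bounded observable tend to its supremum -/

section Tilted

variable {Ω : Type*} [MeasurableSpace Ω] {μ : Measure Ω} [IsProbabilityMeasure μ] {X : Ω → ℝ} {C M : ℝ}

/-- `X e^{tX}` is integrable for a bounded measurable `X`. -/
theorem integrable_mul_exp_mul_of_abs_le_const (hXm : Measurable X) (hC : ∀ ω, |X ω| ≤ C) (t : ℝ) :
    Integrable (fun ω => X ω * Real.exp (t * X ω)) μ := by
  refine Integrable.mono' (integrable_const (C * Real.exp (|t| * C)))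
    (hXm.mul (Real.continuous_exp.measurable.comp (hXm.const_mul t))).aestronglyMeasurable
    (Filter.Eventually.of_forall fun ω => ?_)
  rw [norm_mul, Real.norm_eq_abs, Real.norm_of_nonneg (Real.exp_nonneg _)]
  refine mul_le_mul (hC ω) (Real.exp_le_exp.2 ((le_abs_self _).trans ?_)) (Real.exp_nonneg _)
    ((abs_nonneg _).trans (hC ω))
  rw [abs_mul]
  exact mul_le_mul_of_nonneg_left (hC ω) (abs_nonneg _)

/-- **The tilted mean is at most the supremum**: `(cgf X μ)'(t) ≤ M` if `X ≤ M`. -/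
theorem deriv_cgf_le_of_le (hXm : Measurable X) (hC : ∀ ω, |X ω| ≤ C) (hM : ∀ ω, X ω ≤ M) (t : ℝ) :
    deriv (cgf X μ) t ≤ M := by
  have hint := mem_interior_integrableExpSet_of_abs_le_const (μ := μ) hXm.aestronglyMeasurable hC t
  have hmgf : 0 < mgf X μ t :=
    mgf_pos' (IsProbabilityMeasure.ne_zero μ) (integrable_exp_mul_of_abs_le_const hXm.aestronglyMeasurable hC t)
  rw [deriv_cgf hint, div_le_iff₀ hmgf, mgf, ← integral_const_mul]
  exact integral_mono (integrable_mul_exp_mul_of_abs_le_const hXm hC t)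
    ((integrable_exp_mul_of_abs_le_const hXm.aestronglyMeasurable hC t).const_mul M)
    fun ω => mul_le_mul_of_nonneg_right (hM ω) (Real.exp_nonneg _)

/-- **TILTED MEANS TEND TO THE ESSENTIAL SUPREMUM**: if `|X| ≤ C`, `X ≤ M`, and `μ{M − ε < X} > 0` for every `ε > 0`,
then `(cgf X μ)'(t) = ∫ X e^{tX} dμ / ∫ e^{tX} dμ → M` as `t → ∞`. -/
theorem tendsto_deriv_cgf_atTop (hXm : Measurable X) (hC : ∀ ω, |X ω| ≤ C) (hM : ∀ ω, X ω ≤ M)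
    (hpos : ∀ ε : ℝ, 0 < ε → 0 < μ {ω | M - ε < X ω}) :
    Tendsto (deriv (cgf X μ)) atTop (𝓝 M) := by
  have hint : ∀ t, t ∈ interior (integrableExpSet X μ) := fun t =>
    mem_interior_integrableExpSet_of_abs_le_const (μ := μ) hXm.aestronglyMeasurable hC t
  rw [tendsto_order]
  refine ⟨fun a ha => ?_, fun b hb => Filter.Eventually.of_forall fun t => (deriv_cgf_le_of_le hXm hC hM t).trans_lt hb⟩
  -- the margin `ε`, the good set `A' = {M − ε/2 < X}` of mass `p > 0`, the constant `K`
  set ε : ℝ := (M - a) / 3 with hε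
  have hε0 : 0 < ε := by rw [hε]; linarith
  have hA' : MeasurableSet {ω | M - ε / 2 < X ω} := measurableSet_lt measurable_const hXm
  set p : ℝ := μ.real {ω | M - ε / 2 < X ω} with hp
  have hp0 : 0 < p := by
    rw [hp, measureReal_def]
    exact ENNReal.toReal_pos (hpos (ε / 2) (by positivity)).ne' (measure_ne_top _ _)
  set K : ℝ := |C| + |M| + 2 * ε with hK
  have hK0 : 0 ≤ K := by rw [hK]; positivity
  -- for large `t`: `ε p e^{tε/2} > K`
  have hev : ∀ᶠ t : ℝ in atTop, K < ε * p * Real.exp (t * (ε / 2)) ∧ 0 ≤ t :=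
    (((tendsto_exp_atTop.comp (tendsto_id.atTop_mul_const (by positivity : (0 : ℝ) < ε / 2))).const_mul_atTop
      (by positivity : (0 : ℝ) < ε * p)).eventually_gt_atTop K).and (eventually_ge_atTop 0)
  filter_upwards [hev] with t ⟨hKt, ht0⟩
  have hD : 0 < mgf X μ t :=
    mgf_pos' (IsProbabilityMeasure.ne_zero μ) (integrable_exp_mul_of_abs_le_const hXm.aestronglyMeasurable hC t)
  rw [deriv_cgf (hint t), lt_div_iff₀ hD, mgf]
  -- the key estimate: `∫ (X − (M − 2ε)) e^{tX} ≥ ε p e^{t(M − ε/2)} − K e^{t(M − ε)} > 0`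
  have hfi : Integrable (fun ω => (X ω - (M - 2 * ε)) * Real.exp (t * X ω)) μ := by
    have h := (integrable_mul_exp_mul_of_abs_le_const (μ := μ) hXm hC t).sub
      ((integrable_exp_mul_of_abs_le_const (μ := μ) hXm.aestronglyMeasurable hC t).const_mul (M - 2 * ε))
    refine h.congr (Filter.Eventually.of_forall fun ω => ?_)
    simp only [Pi.sub_apply]
    ring
  have hgi : Integrable (fun ω => ε * Real.exp (t * (M - ε / 2)) * ({ω | M - ε / 2 < X ω}.indicator (fun _ => (1 : ℝ)) ω)
      - K * Real.exp (t * (M - ε))) μ :=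
    (((integrable_const (1 : ℝ)).indicator hA').const_mul _).sub (integrable_const _)
  have hptw : ∀ ω, ε * Real.exp (t * (M - ε / 2)) * ({ω | M - ε / 2 < X ω}.indicator (fun _ => (1 : ℝ)) ω)
      - K * Real.exp (t * (M - ε)) ≤ (X ω - (M - 2 * ε)) * Real.exp (t * X ω) := by
    intro ω
    have hKe : 0 ≤ K * Real.exp (t * (M - ε)) := mul_nonneg hK0 (Real.exp_nonneg _)
    by_cases h1 : M - ε / 2 < X ω
    · simp only [Set.indicator_of_mem (show ω ∈ {ω | M - ε / 2 < X ω} from h1), mul_one]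
      have hx : ε ≤ X ω - (M - 2 * ε) := by linarith
      have he : Real.exp (t * (M - ε / 2)) ≤ Real.exp (t * X ω) :=
        Real.exp_le_exp.2 (mul_le_mul_of_nonneg_left h1.le ht0)
      calc ε * Real.exp (t * (M - ε / 2)) - K * Real.exp (t * (M - ε))
          ≤ ε * Real.exp (t * (M - ε / 2)) := sub_le_self _ hKe
        _ ≤ (X ω - (M - 2 * ε)) * Real.exp (t * X ω) :=
            mul_le_mul hx he (Real.exp_nonneg _) (hε0.le.trans hx)
    · simp only [Set.indicator_of_notMem (show ω ∉ {ω | M - ε / 2 < X ω} from h1), mul_zero, zero_sub]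
      by_cases h2 : 0 ≤ X ω - (M - 2 * ε)
      · exact (neg_nonpos.2 hKe).trans (mul_nonneg h2 (Real.exp_nonneg _))
      · have h2' : X ω - (M - 2 * ε) < 0 := not_le.mp h2
        have he : Real.exp (t * X ω) ≤ Real.exp (t * (M - ε)) :=
          Real.exp_le_exp.2 (mul_le_mul_of_nonneg_left (by linarith) ht0)
        have hc : -K ≤ X ω - (M - 2 * ε) := by
          have h3 := (abs_le.mp (hC ω)).1
          rw [hK]
          linarith [le_abs_self C, le_abs_self M]
        calc -(K * Real.exp (t * (M - ε))) = (-K) * Real.exp (t * (M - ε)) := by ring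
          _ ≤ (X ω - (M - 2 * ε)) * Real.exp (t * (M - ε)) :=
              mul_le_mul_of_nonneg_right hc (Real.exp_nonneg _)
          _ ≤ (X ω - (M - 2 * ε)) * Real.exp (t * X ω) := mul_le_mul_of_nonpos_left he h2'.le
  have hlow : ε * Real.exp (t * (M - ε / 2)) * p - K * Real.exp (t * (M - ε))
      ≤ ∫ ω, (X ω - (M - 2 * ε)) * Real.exp (t * X ω) ∂μ := by
    have h := integral_mono hgi hfi hptw
    rwa [integral_sub (((integrable_const (1 : ℝ)).indicator hA').const_mul _) (integrable_const _),
      integral_const_mul, integral_indicator_const _ hA', integral_const, smul_eq_mul, smul_eq_mul, mul_one,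
      probReal_univ, one_mul] at h
  have hpos' : 0 < ε * Real.exp (t * (M - ε / 2)) * p - K * Real.exp (t * (M - ε)) := by
    have hsplit : Real.exp (t * (M - ε / 2)) = Real.exp (t * (M - ε)) * Real.exp (t * (ε / 2)) := by
      rw [← Real.exp_add]; congr 1; ring
    rw [hsplit, sub_pos]
    calc K * Real.exp (t * (M - ε)) < ε * p * Real.exp (t * (ε / 2)) * Real.exp (t * (M - ε)) :=
          mul_lt_mul_of_pos_right hKt (Real.exp_pos _)
      _ = ε * (Real.exp (t * (M - ε)) * Real.exp (t * (ε / 2))) * p := by ring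
  have hsub : ∫ ω, (X ω - (M - 2 * ε)) * Real.exp (t * X ω) ∂μ
      = ∫ ω, X ω * Real.exp (t * X ω) ∂μ - (M - 2 * ε) * ∫ ω, Real.exp (t * X ω) ∂μ := by
    rw [← integral_const_mul, ← integral_sub (integrable_mul_exp_mul_of_abs_le_const hXm hC t)
      ((integrable_exp_mul_of_abs_le_const hXm.aestronglyMeasurable hC t).const_mul _)]
    refine integral_congr_ae (Filter.Eventually.of_forall fun ω => ?_)
    ring
  have ha' : a < M - 2 * ε := by rw [hε]; linarith
  have hDpos : 0 < ∫ ω, Real.exp (t * X ω) ∂μ := hD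
  nlinarith [hlow, hpos', hsub, ha', hDpos, mul_lt_mul_of_pos_right ha' hDpos]

end Tilted

/-! ### 4. Weak coupling: the `U(N)` plaquette tends to `1` -/

/-- `Re tr U ≤ N` on `U(N)`. -/
theorem trace_re_le_card {n : Type*} [Fintype n] [DecidableEq n] (u : Matrix.unitaryGroup n ℂ) :
    ((u : Matrix.unitaryGroup n ℂ) : Matrix n n ℂ).trace.re ≤ Fintype.card n :=
  (abs_le.mp (abs_trace_re_le_card u)).2

/-- The set `{Re tr U > N − ε}` has positive Haar measure in `U(N)` (it is open and contains `1`). -/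
theorem haar_unitaryGroup_trace_re_gt_pos (N : ℕ) {ε : ℝ} (hε : 0 < ε) :
    0 < haarProbability (Matrix.unitaryGroup (Fin N) ℂ)
      {u | (N : ℝ) - ε < ((u : Matrix.unitaryGroup (Fin N) ℂ) : Matrix (Fin N) (Fin N) ℂ).trace.re} := by
  haveI : (haarProbability (Matrix.unitaryGroup (Fin N) ℂ)).IsHaarMeasure := Measure.isHaarMeasure_haarMeasure ⊤
  have hopen : IsOpen {u : Matrix.unitaryGroup (Fin N) ℂ |
      (N : ℝ) - ε < ((u : Matrix.unitaryGroup (Fin N) ℂ) : Matrix (Fin N) (Fin N) ℂ).trace.re} :=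
    isOpen_lt continuous_const (Complex.continuous_re.comp (continuous_id.matrix_trace.comp continuous_subtype_val))
  refine hopen.measure_pos _ ⟨1, ?_⟩
  simp only [Set.mem_setOf_eq]
  rw [show (((1 : Matrix.unitaryGroup (Fin N) ℂ)) : Matrix (Fin N) (Fin N) ℂ) = 1 from rfl, Matrix.trace_one]
  simp only [Complex.natCast_re, Fintype.card_fin]
  linarith

/-- **`(log det[I_{|i−j|}])'(β) → N` as `β → ∞`** (the tilted mean of `Re tr U` tends to its maximum `N`). -/
theorem tendsto_deriv_log_det_besselI_toeplitz_atTop (N : ℕ) :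
    Tendsto (deriv fun x : ℝ => Real.log (Matrix.of fun i j : Fin N => besselI ((i : ℤ) - (j : ℤ)).natAbs x).det)
      atTop (𝓝 (N : ℝ)) := by
  have hcgf : (fun x : ℝ => Real.log (Matrix.of fun i j : Fin N => besselI ((i : ℤ) - (j : ℤ)).natAbs x).det)
      = cgf (fun u : Matrix.unitaryGroup (Fin N) ℂ => ((u : Matrix.unitaryGroup (Fin N) ℂ) :
          Matrix (Fin N) (Fin N) ℂ).trace.re) (haarProbability (Matrix.unitaryGroup (Fin N) ℂ)) :=
    funext fun x => by rw [cgf, mgf_trace_re_unitaryGroup]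
  rw [hcgf]
  have h := tendsto_deriv_cgf_atTop (μ := haarProbability (Matrix.unitaryGroup (Fin N) ℂ))
    (X := fun u : Matrix.unitaryGroup (Fin N) ℂ => ((u : Matrix.unitaryGroup (Fin N) ℂ) : Matrix (Fin N) (Fin N) ℂ).trace.re)
    (C := Fintype.card (Fin N)) (M := (N : ℝ))
    (Complex.continuous_re.comp (continuous_id.matrix_trace.comp continuous_subtype_val)).measurable
    (fun u => abs_trace_re_le_card u) (fun u => by simpa [Fintype.card_fin] using trace_re_le_card u)
    (fun ε hε => haar_unitaryGroup_trace_re_gt_pos N hε)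
  exact h

/-- **THE `U(N)` ONE-PLAQUETTE PLAQUETTE TENDS TO `1` AT WEAK COUPLING, EVERY `N ≥ 1`.** -/
theorem tendsto_unitary_plaquette_atTop (N : ℕ) [NeZero N] :
    Tendsto (fun β : ℝ =>
      (∫ u, ((u : Matrix.unitaryGroup (Fin N) ℂ) : Matrix (Fin N) (Fin N) ℂ).trace.re / N *
          Real.exp (-(β * ((N : ℝ) - ((u : Matrix.unitaryGroup (Fin N) ℂ) : Matrix (Fin N) (Fin N) ℂ).trace.re)))
        ∂(haarProbability (Matrix.unitaryGroup (Fin N) ℂ)))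
      / (∫ u, Real.exp (-(β * ((N : ℝ) - ((u : Matrix.unitaryGroup (Fin N) ℂ) : Matrix (Fin N) (Fin N) ℂ).trace.re)))
        ∂(haarProbability (Matrix.unitaryGroup (Fin N) ℂ)))) atTop (𝓝 1) := by
  simp_rw [unitary_plaquette_eq_deriv_log_det]
  have hN : (N : ℝ) ≠ 0 := Nat.cast_ne_zero.2 (NeZero.ne N)
  have h := (tendsto_deriv_log_det_besselI_toeplitz_atTop N).const_mul (1 / (N : ℝ))
  rwa [show 1 / (N : ℝ) * N = 1 by field_simp] at h

/-! ### 5. Global consequences: `det[I_{|i−j|}(0)] = 1`, `det[I_{|i−j|}(x)] ≥ 1`, and evenness in `x` -/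

/-- **`det[I_{|i−j|}(0)]_{N×N} = 1`** (`mgf` at `0` of a probability measure). -/
theorem det_besselI_toeplitz_zero (N : ℕ) :
    (Matrix.of fun i j : Fin N => besselI ((i : ℤ) - (j : ℤ)).natAbs 0).det = 1 := by
  rw [← mgf_trace_re_unitaryGroup N 0, mgf_zero]

/-- **`det[I_{|i−j|}(x)]_{N×N} ≥ 1` for every `N` and every real `x`**: `log det` is convex with derivative `0` at
`x = 0` (Jensen: `∫ e^{x Re tr U} dU ≥ e^{x ∫ Re tr U dU} = 1`). -/
theorem one_le_det_besselI_toeplitz (N : ℕ) (x : ℝ) :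
    1 ≤ (Matrix.of fun i j : Fin N => besselI ((i : ℤ) - (j : ℤ)).natAbs x).det := by
  set f : ℝ → ℝ := fun x => Real.log (Matrix.of fun i j : Fin N => besselI ((i : ℤ) - (j : ℤ)).natAbs x).det with hf
  have hcgf : f = cgf (fun u : Matrix.unitaryGroup (Fin N) ℂ => ((u : Matrix.unitaryGroup (Fin N) ℂ) :
      Matrix (Fin N) (Fin N) ℂ).trace.re) (haarProbability (Matrix.unitaryGroup (Fin N) ℂ)) :=
    funext fun x => by rw [hf, cgf, mgf_trace_re_unitaryGroup]
  have ha := analyticOnNhd_cgf_univ (aestronglyMeasurable_trace_re_unitaryGroup N) (fun u => abs_trace_re_le_card u)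
  rw [← hcgf] at ha
  have hd : Differentiable ℝ f := fun t => (ha t (Set.mem_univ t)).differentiableAt
  have hmono : Monotone (deriv f) := by
    rw [hcgf]; exact monotone_deriv_cgf (aestronglyMeasurable_trace_re_unitaryGroup N) (fun u => abs_trace_re_le_card u)
  have hd0 : deriv f 0 = 0 := deriv_log_det_besselI_toeplitz_zero N
  have hf0 : f 0 = 0 := by simp only [hf, det_besselI_toeplitz_zero, Real.log_one]
  -- `f x ≥ f 0 = 0` on both sides of `0`
  have hfx : 0 ≤ f x := by
    rcases le_total 0 x with hx | hx
    · have hm : MonotoneOn f (Set.Ici 0) :=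
        monotoneOn_of_deriv_nonneg (convex_Ici 0) hd.continuous.continuousOn (hd.differentiableOn)
          fun t ht => by
            rw [← hd0]
            exact hmono (le_of_lt (by simpa using ht))
      simpa [hf0] using hm (Set.mem_Ici.2 le_rfl) (Set.mem_Ici.2 hx) hx
    · have hm : AntitoneOn f (Set.Iic 0) :=
        antitoneOn_of_deriv_nonpos (convex_Iic 0) hd.continuous.continuousOn (hd.differentiableOn)
          fun t ht => by
            rw [← hd0]
            exact hmono (le_of_lt (by simpa using ht))
      simpa [hf0] using hm (Set.mem_Iic.2 hx) (Set.mem_Iic.2 le_rfl) hx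
  have hpos := det_besselI_toeplitz_fin_pos N x
  rwa [hf, Real.log_nonneg_iff hpos] at hfx


/-- **`det[I_{|i−j|}(−x)] = det[I_{|i−j|}(x)]`**: the `U(N)` one-plaquette partition function is even in the coupling
(`U ↦ −U` preserves the Haar measure and flips the sign of `Re tr U`). -/
theorem det_besselI_toeplitz_neg (N : ℕ) (x : ℝ) :
    (Matrix.of fun i j : Fin N => besselI ((i : ℤ) - (j : ℤ)).natAbs (-x)).det
      = (Matrix.of fun i j : Fin N => besselI ((i : ℤ) - (j : ℤ)).natAbs x).det := by
  rw [← integral_haar_unitaryGroup_fin_exp_mul_trace_re, ← integral_haar_unitaryGroup_fin_exp_mul_trace_re]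
  haveI : (haarProbability (Matrix.unitaryGroup (Fin N) ℂ)).IsHaarMeasure := Measure.isHaarMeasure_haarMeasure ⊤
  rw [← integral_mul_left_eq_self (μ := haarProbability (Matrix.unitaryGroup (Fin N) ℂ))
    (fun u : Matrix.unitaryGroup (Fin N) ℂ =>
      Real.exp (x * ((u : Matrix.unitaryGroup (Fin N) ℂ) : Matrix (Fin N) (Fin N) ℂ).trace.re)) (-1)]
  refine integral_congr_ae (Filter.Eventually.of_forall fun u => ?_)
  have hcoe : (((-1 * u : Matrix.unitaryGroup (Fin N) ℂ)) : Matrix (Fin N) (Fin N) ℂ)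
      = -((u : Matrix.unitaryGroup (Fin N) ℂ) : Matrix (Fin N) (Fin N) ℂ) := by
    rw [neg_one_mul, Unitary.coe_neg]
  simp only [hcoe, Matrix.trace_neg, Complex.neg_re]
  ring_nf

end Summit.Ventures.LatticeQCDFlow.Scoring
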